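import Literature.RingTheory.CentralSimple.ReducedDegreeFaithfulEquality
import Literature.RingTheory.CentralSimple.MaximalEtaleIsMaximalCommutative
import Mathlib.LinearAlgebra.Semisimple
import Mathlib.LinearAlgebra.Matrix.ToLin
import Mathlib.LinearAlgebra.Matrix.GeneralLinearGroup.Defs
import Mathlib.RingTheory.Jacobson.Semiprimary
import HarnessLib

/-!
# `[End(V, ρ) : F]_red = dim V` for a representation of a group of multiplicative type (Milne, *Complex
# Multiplication*, Ch. I §4 Prop. 4.1) — the reduced degree of the commutant of a commutative semisimple algebra of
# operators

Family `hodge`, lane `lit-hodgefound` (Track 2 foundations library; skeleton seat `lit-hodgefound-skel-3`, generation 58,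
row **A3-G142** «Milne CM Props. 4.1, 4.2, Cor. 4.7»), topic `Literature/RingTheory/CentralSimple`, namespace
`Literature.RingTheory.CentralSimple`.  FILE 1 of the row: the pure algebra.  Sequel, BY NAME (nothing restated), of
`ReducedDegree` (A3-G141: the reduced degree `reducedDegree F B = [B : F]_red`, Milne CM (1.2)–(1.3), with
`reducedDegree_le_finrank_of_le_end` = Prop. 1.2 for subalgebras of `End_F(V)` and `reducedDegree_eq_finrank_of_comm`),
of `ReducedDegreeFaithfulEquality` (A3-G141 FILE 3: `exists_centralizer_algEquiv_pi_matrix_field` — the commutant of a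
commutative reduced `Z ⊆ End_F(V)` is `∏ᵢ M_{dᵢ}(Kᵢ)` over fields) and of p38's `MaximalEtaleIsMaximalCommutative`
(Bourbaki VIII §14 n°7 Cor. 1: `exists_le_maximal_comm_isSemisimpleRing` — every commutative semisimple subalgebra of a
central simple algebra lies in a maximal commutative one, of degree `deg B`).  THEOREMS ONLY (no definition, no
instance, no named fact; net debt 0, D-0026).

## The print

J. S. Milne, *Complex Multiplication* (course notes v0.10, 2020) [MilneCM2006], Ch. I §4 «Review of algebraic groups
of multiplicative type», p. 34 (open text `paper:url-8ccc30e4daab`, p0034 L1–L21), VERBATIM: «This is a linear condition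
on `α`, and so, for any field `K` containing `k`, `End(V_K, ρ_K) = End(V, ρ) ⊗_k K`. (27)  **PROPOSITION 4.1** Let `G` be
a group of multiplicative type over a field `k` of characteristic zero. For any representation `(V, ρ)`,
`[End(V, ρ) : k]_red = dim V`.  PROOF. If `G` is diagonalizable, then `V = ⊕_m V_m` (sum over the group-like elements
of `k[G]`), and `End(V, ρ) ≃ ∏_m End_{k-linear}(V_m) ≃ ∏_m M_{dim(V_m)}(k)`, from which the statement follows. In the
general case, `G` becomes diagonalizable over a finite extension `K` of `k`, and `dim_k V = dim_K(V ⊗_k K) =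
[End(V, ρ) ⊗_k K : K]_red = [End(V, ρ) : k]_red`.»  It is used on p. 35 (Prop. 4.2, proof): «Conversely, let
`T ↪ GL_{H₁(A,ℚ)}` be a subtorus. If `ℂ^× ⊆ T(ℝ)`, then `End⁰(A) ⊇ End(H₁(A, ℚ), ρ)`, and Proposition 4.1 shows that `A`
has complex multiplication.»

## Reading (how «group of multiplicative type» is rendered without group schemes)

A representation `ρ` of a group `G` of multiplicative type on `V` acts through a commutative `k`-subalgebra
`A_ρ ⊆ End_k(V)` which becomes diagonalizable over a finite extension, i.e. `A_ρ` is commutative and REDUCED (= étale in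
characteristic `0`; e.g. `A_ρ = ⊕_m k·e_m` spanned by the weight projectors when `G` is diagonalizable), and
`End(V, ρ) = C_{End_k(V)}(A_ρ)` is its commutant; conversely every commutative reduced `A ⊆ End_k(V)` is the algebra of
the torus `Res (𝔾_m)_{A/k} = A^×` (Milne's `T^E = (𝔾_m)_{E/ℚ}` of p. 34).  Over a perfect field, commutative reduced
subalgebras are exactly those generated by pairwise commuting SEMISIMPLE endomorphisms (§1: `isReduced_iff_forall_isSemisimple`,
`isReduced_adjoin_of_forall_isSemisimple`), so Prop. 4.1 is stated below for (a) a commutative reduced subalgebra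
`A ⊆ End_F(V)` (any field `F` — the characteristic-zero hypothesis of the print is not needed for this form), (b) a
pairwise commuting set ∕ a commutative group of semisimple operators (perfect `F`), (c) the same for matrices and for
subgroups of `GL_n(F)` («subtorus `T ↪ GL_V`»).  The proof is NOT Milne's base change to the diagonalizable case but the
intrinsic one available in the tree: `C(A)` contains a maximal commutative semisimple subalgebra `L ⊇ A` of `End_F(V)`,
which has `dim L = dim V` (Bourbaki VIII §14 n°6 Prop. 3 ∕ n°7 Cor. 1, p38), so `[C(A)]_red ≥ dim V`; and every
subalgebra of `End_F(V)` has `[·]_red ≤ dim V` (Prop. 1.2).  Milne's displayed structure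
«`End(V, ρ) ≃ ∏_m M_{dim V_m}`» is the tree's `exists_centralizer_algEquiv_pi_matrix_field` (A3-G141 FILE 3), used in §2
only to record that the commutant is semisimple; (27) is the tree's `Commutant.span_baseChange_centralizer_eq`
(`RingTheory/SimpleModule/CommutantDeligneCMCriterion`) and is not restated.

## What is formalised (`F` a field, `V` a finite-dimensional `F`-space, `A ⊆ End_F(V)` a subalgebra)

* §1 `isSemisimple_of_mem_of_isReduced` (elements of a reduced subalgebra are semisimple endomorphisms),
  `isReduced_of_forall_isSemisimple`, `isReduced_iff_forall_isSemisimple`; over a perfect field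
  `isSemisimple_of_mem_adjoin_of_forall_isSemisimple`, `isReduced_adjoin_of_forall_isSemisimple` (the algebra generated
  by pairwise commuting semisimple operators is commutative reduced — «`G` becomes diagonalizable over a finite
  extension»).
* §2 `isSemisimpleRing_centralizer_of_comm_isReduced` («`End(V, ρ) ≃ ∏_m M_{dim V_m}`»: the commutant is semisimple),
  `exists_le_le_centralizer_comm_isReduced_finrank_eq` (a commutative reduced `L`, `A ⊆ L ⊆ C(A)`, `dim L = dim V`).
* §3 **PROP. 4.1** `reducedDegree_centralizer_eq_finrank` (`[C(A) : F]_red = dim_F V`) and the form used in Prop. 4.2,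
  `reducedDegree_eq_finrank_of_centralizer_le` (`C(A) ⊆ R ⊆ End_F(V)` ⟹ `[R : F]_red = dim V`); set form
  `reducedDegree_centralizer_eq_finrank_of_forall_isSemisimple` (pairwise commuting semisimple operators, perfect `F`),
  one operator `reducedDegree_centralizer_singleton_eq_finrank` (any `F`), commutative groups of semisimple
  automorphisms `reducedDegree_centralizer_subgroup_eq_finrank`.
* §4 Matrix forms on `V = F^ι`: `Matrix.reducedDegree_centralizer_eq_card`, `Matrix.reducedDegree_eq_card_of_centralizer_le`,
  `Matrix.reducedDegree_centralizer_eq_card_of_forall_isSemisimple`, and for a commutative subgroup `T ≤ GL_ι(F)` of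
  semisimple elements («a subtorus `T ↪ GL_V`») `Matrix.reducedDegree_centralizer_generalLinearGroup_eq_card`.

## References

* [MilneCM2006] J. S. Milne, *Complex Multiplication* (2006/2020), Ch. I §4, (27) and Prop. 4.1 (p. 34); Prop. 4.2
  (proof, p. 35); §1 Prop. 1.2–1.3 (p. 9).
* [BourbakiAlgebreVIII2012] N. Bourbaki, *Algèbre*, Ch. VIII (2012), §14 n°6 Prop. 3, n°7 Prop. 4 and Cor. 1
  (pp. A VIII.258–260).
* [Humphreys1972] J. E. Humphreys, *Introduction to Lie Algebras and Representation Theory* (1972), §4.2 (p. 17: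
  semisimple = minimal polynomial with distinct roots; commuting semisimple endomorphisms have semisimple sums).
-/

open Module

namespace Literature.RingTheory.CentralSimple

universe u v w

/-! ## §0 Plumbing: reduced subalgebras elementwise, transport along algebra isomorphisms -/

section Helpers

variable {R : Type*} [CommSemiring R] {B : Type*} [Semiring B] [Algebra R B] {B' : Type*} [Semiring B'] [Algebra R B']

/-- A subalgebra is reduced iff it contains no non-zero nilpotent element of the ambient algebra. [folklore] -/
private theorem isReduced_subalgebra_iff'' (S : Subalgebra R B) :
    IsReduced S ↔ ∀ x ∈ S, IsNilpotent x → x = 0 := by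
  constructor
  · rintro h x hx ⟨n, hn⟩
    have h0 : (⟨x, hx⟩ : S) = 0 :=
      h.eq_zero _ ⟨n, Subtype.ext (by rw [SubmonoidClass.coe_pow, ZeroMemClass.coe_zero]; exact hn)⟩
    exact congrArg Subtype.val h0
  · intro h
    refine ⟨fun x hx => ?_⟩
    obtain ⟨n, hn⟩ := hx
    have h1 : (x : B) ^ n = 0 := by rw [← SubmonoidClass.coe_pow, hn, ZeroMemClass.coe_zero]
    exact Subtype.ext (by rw [ZeroMemClass.coe_zero]; exact h x x.2 ⟨n, h1⟩)

/-- A subalgebra contained in a reduced subalgebra is reduced. [folklore] -/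
private theorem isReduced_of_le'' {S T : Subalgebra R B} (h : S ≤ T) [hT : IsReduced T] : IsReduced S := by
  rw [isReduced_subalgebra_iff''] at hT ⊢
  exact fun x hx hn => hT x (h hx) hn

/-- The image of the centralizer of `s` under an algebra isomorphism is the centralizer of the image of `s`. [folklore] -/
private theorem map_centralizer_algEquiv (e : B ≃ₐ[R] B') (s : Set B) :
    (Subalgebra.centralizer R s).map (e : B →ₐ[R] B') = Subalgebra.centralizer R (e '' s) := by
  ext y
  simp only [Subalgebra.mem_map, Subalgebra.mem_centralizer_iff]
  constructor
  · rintro ⟨x, hx, rfl⟩ _ ⟨g, hg, rfl⟩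
    change e g * e x = e x * e g
    rw [← map_mul, ← map_mul, hx g hg]
  · intro hy
    refine ⟨e.symm y, fun g hg => ?_, ?_⟩
    · apply e.injective
      rw [map_mul, map_mul, e.apply_symm_apply]
      exact hy _ ⟨g, hg, rfl⟩
    · change e (e.symm y) = y
      exact e.apply_symm_apply y

end Helpers

section HelpersField

variable {F : Type u} [Field F] {B : Type v} [Ring B] [Algebra F B] {B' : Type w} [Ring B'] [Algebra F B']

/-- The reduced degree of a subalgebra is that of its image under an algebra isomorphism. [folklore] -/
private theorem reducedDegree_map_algEquiv [FiniteDimensional F B] [FiniteDimensional F B'] (e : B ≃ₐ[F] B')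
    (S : Subalgebra F B) : reducedDegree F ↥(S.map (e : B →ₐ[F] B')) = reducedDegree F ↥S :=
  (reducedDegree_eq_of_algEquiv (Subalgebra.equivMapOfInjective S (e : B →ₐ[F] B') e.injective)).symm

/-- The image of a reduced subalgebra under an algebra isomorphism is reduced. [folklore] -/
private theorem isReduced_map_algEquiv (e : B ≃ₐ[F] B') (A : Subalgebra F B) [IsReduced A] :
    IsReduced ↥(A.map (e : B →ₐ[F] B')) :=
  isReduced_of_injective (Subalgebra.equivMapOfInjective A (e : B →ₐ[F] B') e.injective).symm
    (Subalgebra.equivMapOfInjective A (e : B →ₐ[F] B') e.injective).symm.injective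

/-- The image of a subalgebra under an algebra isomorphism, as a set. [folklore] -/
private theorem image_coe_eq_coe_map (e : B ≃ₐ[F] B') (A : Subalgebra F B) :
    (e : B → B') '' (A : Set B) = ((A.map (e : B →ₐ[F] B')) : Set B') := by
  ext y
  constructor
  · rintro ⟨x, hx, rfl⟩
    exact ⟨x, hx, rfl⟩
  · rintro ⟨x, hx, rfl⟩
    exact ⟨x, hx, rfl⟩

/-- Commutativity passes to the image under an algebra map. [folklore] -/
private theorem map_comm_of_comm' (A : Subalgebra F B) (hcomm : ∀ x ∈ A, ∀ y ∈ A, x * y = y * x) (f : B →ₐ[F] B') :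
    ∀ x ∈ A.map f, ∀ y ∈ A.map f, x * y = y * x := by
  rintro _ ⟨a, ha, rfl⟩ _ ⟨b, hb, rfl⟩
  rw [← map_mul, ← map_mul, hcomm a ha b hb]

end HelpersField

/-! ## §1 «Multiplicative type», as algebras of operators: reduced ⟺ all elements semisimple -/

section Semisimple

variable {F : Type u} [Field F] {V : Type v} [AddCommGroup V] [Module F V] [FiniteDimensional F V]

/-- **An element of a reduced subalgebra `A ⊆ End_F(V)` is a semisimple endomorphism**: its minimal polynomial over
`F` is radical (`A` being reduced), hence square-free, i.e. «the roots of its minimal polynomial are all distinct».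
Any field `F`. [cite: Humphreys1972, §4.2 (p. 17: «Call `x ∈ End V` semisimple if the roots of its minimal polynomial over `F` are all distinct»)]
[cite: MilneCM2006, Ch. I §4 Prop. 4.1 (proof: «`G` becomes diagonalizable over a finite extension `K` of `k`»)] -/
theorem isSemisimple_of_mem_of_isReduced (A : Subalgebra F (Module.End F V)) [IsReduced A] {a : Module.End F V}
    (ha : a ∈ A) : a.IsSemisimple := by
  set x : A := ⟨a, ha⟩
  have hint : IsIntegral F x := Algebra.IsIntegral.isIntegral x
  have hsq : Squarefree (minpoly F x) := (minpoly.isRadical F x).squarefree (minpoly.ne_zero hint)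
  refine Module.End.isSemisimple_of_squarefree_aeval_eq_zero hsq ?_
  rw [show a = (x : Module.End F V) from rfl, ← Polynomial.aeval_subalgebra_coe, minpoly.aeval,
    ZeroMemClass.coe_zero]

omit [FiniteDimensional F V] in
/-- **A subalgebra of `End_F(V)` all of whose elements are semisimple is reduced** (a nilpotent semisimple endomorphism
vanishes). Any field `F`. [cite: Humphreys1972, §4.2 Prop. (a) (p. 17: uniqueness of `x = x_s + x_n`)] -/
theorem isReduced_of_forall_isSemisimple (A : Subalgebra F (Module.End F V))
    (h : ∀ a ∈ A, Module.End.IsSemisimple a) : IsReduced A := by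
  rw [isReduced_subalgebra_iff'']
  exact fun x hx hn => Module.End.eq_zero_of_isNilpotent_isSemisimple hn (h x hx)

/-- **Reduced ⟺ every element semisimple**, for subalgebras of `End_F(V)` over any field (for a COMMUTATIVE subalgebra
this is «diagonalizable over a finite extension», i.e. the algebra of a group of multiplicative type).
[cite: MilneCM2006, Ch. I §4 Prop. 4.1 (proof)] [cite: Humphreys1972, §4.2 (p. 17)] -/
theorem isReduced_iff_forall_isSemisimple (A : Subalgebra F (Module.End F V)) :
    IsReduced A ↔ ∀ a ∈ A, Module.End.IsSemisimple a :=
  ⟨fun _ _ ha => isSemisimple_of_mem_of_isReduced A ha, isReduced_of_forall_isSemisimple A⟩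

omit [FiniteDimensional F V] in
/-- The algebra generated by a pairwise commuting set of endomorphisms is commutative. [folklore] -/
private theorem adjoin_comm_of_comm {S : Set (Module.End F V)} (hS : ∀ a ∈ S, ∀ b ∈ S, a * b = b * a) :
    ∀ x ∈ Algebra.adjoin F S, ∀ y ∈ Algebra.adjoin F S, x * y = y * x := by
  intro x hx y hy
  exact congrArg Subtype.val ((Algebra.isMulCommutative_adjoin F hS).is_comm.comm ⟨x, hx⟩ ⟨y, hy⟩)

/-- **Over a perfect field, the algebra generated by pairwise commuting semisimple endomorphisms consists of semisimple
endomorphisms** («two commuting semisimple endomorphisms … their sum or difference is again semisimple»; Mathlib's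
`Module.End.IsSemisimple.of_mem_adjoin_pair`, iterated along `Algebra.adjoin_induction`).
[cite: Humphreys1972, §4.2 (p. 17)] [cite: MilneCM2006, Ch. I §4 Prop. 4.1 (proof)] -/
theorem isSemisimple_of_mem_adjoin_of_forall_isSemisimple [PerfectField F] {S : Set (Module.End F V)}
    (hS : ∀ a ∈ S, ∀ b ∈ S, a * b = b * a) (hss : ∀ a ∈ S, Module.End.IsSemisimple a) {x : Module.End F V}
    (hx : x ∈ Algebra.adjoin F S) : x.IsSemisimple := by
  have hcomm := adjoin_comm_of_comm (F := F) hS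
  induction hx using Algebra.adjoin_induction with
  | mem a ha => exact hss a ha
  | algebraMap r =>
    rw [Algebra.algebraMap_eq_smul_one]
    exact Module.End.IsSemisimple_smul r Module.End.isSemisimple_id
  | add y z hy hz hy' hz' =>
    exact Module.End.IsSemisimple.add_of_commute (hcomm y hy z hz) hy' hz'
  | mul y z hy hz hy' hz' =>
    exact Module.End.IsSemisimple.mul_of_commute (hcomm y hy z hz) hy' hz'

omit [FiniteDimensional F V] in
/-- Hence **the algebra generated by pairwise commuting semisimple endomorphisms is (commutative and) reduced** — the
algebra `A_ρ` of a group of multiplicative type, perfect base field. [cite: MilneCM2006, Ch. I §4 Prop. 4.1 (proof)]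
[cite: Humphreys1972, §4.2 (p. 17)] -/
theorem isReduced_adjoin_of_forall_isSemisimple [FiniteDimensional F V] [PerfectField F] {S : Set (Module.End F V)}
    (hS : ∀ a ∈ S, ∀ b ∈ S, a * b = b * a) (hss : ∀ a ∈ S, Module.End.IsSemisimple a) :
    IsReduced ↥(Algebra.adjoin F S) :=
  isReduced_of_forall_isSemisimple _ fun _ hx => isSemisimple_of_mem_adjoin_of_forall_isSemisimple hS hss hx

omit [FiniteDimensional F V] in
/-- The commutant of a set is the commutant of the algebra it generates. [folklore] -/
private theorem centralizer_eq_centralizer_adjoin (S : Set (Module.End F V)) :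
    Subalgebra.centralizer F S = Subalgebra.centralizer F (Algebra.adjoin F S : Set (Module.End F V)) := by
  apply le_antisymm
  · intro z hz
    rw [Subalgebra.mem_centralizer_iff] at hz ⊢
    intro g hg
    exact (Algebra.commute_of_mem_adjoin_of_forall_mem_commute hg fun b hb => (hz b hb).symm).eq.symm
  · exact Subalgebra.centralizer_le F S _ Algebra.subset_adjoin

end Semisimple

/-! ## §2 The commutant of a commutative reduced algebra of operators: semisimple, with a maximal étale subalgebra of
## dimension `dim V` -/

section Commutant

variable {F : Type u} [Field F] {V : Type v} [AddCommGroup V] [Module F V] [FiniteDimensional F V]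

/-- `End_F(V)` is a simple ring for `V ≠ 0` (`≅ M_n(F)`). [folklore] -/
private theorem isSimpleRing_end' [Nontrivial V] : IsSimpleRing (Module.End F V) := by
  have hn : 0 < finrank F V := finrank_pos
  haveI : Nonempty (Fin (finrank F V)) := ⟨⟨0, hn⟩⟩
  exact IsSimpleRing.of_ringEquiv (LinearMap.toMatrixAlgEquiv (Module.finBasis F V)).symm.toRingEquiv inferInstance

omit [FiniteDimensional F V] in
/-- A commutative subalgebra lies in its own commutant. [folklore] -/
private theorem le_centralizer_of_comm (A : Subalgebra F (Module.End F V)) (hcomm : ∀ x ∈ A, ∀ y ∈ A, x * y = y * x) :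
    A ≤ Subalgebra.centralizer F (A : Set (Module.End F V)) := by
  intro a ha
  rw [Subalgebra.mem_centralizer_iff]
  exact fun g hg => hcomm g hg a ha

/-- **«`End(V, ρ) ≃ ∏_m M_{dim V_m}(k)`»: the commutant of a commutative reduced `A ⊆ End_F(V)` is a SEMISIMPLE
ring** (it is `∏ᵢ M_{dᵢ}(Kᵢ)` over fields, A3-G141 FILE 3 `exists_centralizer_algEquiv_pi_matrix_field`). Any field `F`.
[cite: MilneCM2006, Ch. I §4 Prop. 4.1 (proof: «`End(V, ρ) ≃ ∏_m End_{k-linear}(V_m) ≃ ∏_m M_{dim(V_m)}(k)`»)] -/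
theorem isSemisimpleRing_centralizer_of_comm_isReduced (A : Subalgebra F (Module.End F V))
    (hcomm : ∀ x ∈ A, ∀ y ∈ A, x * y = y * x) [IsReduced A] :
    IsSemisimpleRing ↥(Subalgebra.centralizer F (A : Set (Module.End F V))) := by
  obtain ⟨n, K, _, _, d, hd, ⟨e⟩⟩ := exists_centralizer_algEquiv_pi_matrix_field A hcomm
  exact e.symm.toRingEquiv.isSemisimpleRing

open scoped IsMulCommutative in
/-- **A maximal étale subalgebra of `End(V, ρ)` containing the torus**: for a commutative reduced `A ⊆ End_F(V)` there
is a commutative reduced `L` with `A ⊆ L ⊆ C(A)` and `dim_F L = dim_F V` (`L` = a maximal commutative subalgebra of the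
central simple `End_F(V)` above `A`, Bourbaki VIII §14 n°7 Cor. 1, of degree `dim V` by n°6 Prop. 3 — p38's
`exists_le_maximal_comm_isSemisimpleRing`; for `V = 0` take `L = A`).  This is Deligne's «the commutant of `G` therefore
contains étale commutative algebras of rank `dim H₁(A, ℚ)`» with the torus placed INSIDE the étale algebra.
[cite: MilneCM2006, Ch. I §4 Prop. 4.1] [cite: BourbakiAlgebreVIII2012, VIII §14 n°7 Cor. 1 and n°6 Prop. 3 (pp. A VIII.258–260)] -/
theorem exists_le_le_centralizer_comm_isReduced_finrank_eq (A : Subalgebra F (Module.End F V))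
    (hcomm : ∀ x ∈ A, ∀ y ∈ A, x * y = y * x) [hA : IsReduced A] :
    ∃ L : Subalgebra F (Module.End F V), A ≤ L ∧ L ≤ Subalgebra.centralizer F (A : Set (Module.End F V)) ∧
      (∀ x ∈ L, ∀ y ∈ L, x * y = y * x) ∧ IsReduced L ∧ finrank F L = finrank F V := by
  rcases subsingleton_or_nontrivial V with hV | hV
  · -- `V = 0`: `End_F(V) = 0`, everything has dimension `0`
    haveI : Subsingleton (Module.End F V) := ⟨fun f g => LinearMap.ext fun v => Subsingleton.elim _ _⟩
    refine ⟨A, le_rfl, le_centralizer_of_comm A hcomm, hcomm, hA, ?_⟩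
    rw [Module.finrank_zero_of_subsingleton, Module.finrank_zero_of_subsingleton]
  · haveI : IsMulCommutative A := ⟨⟨fun a b => Subtype.ext (hcomm a a.2 b b.2)⟩⟩
    haveI : IsArtinianRing A := IsArtinianRing.of_finite F A
    haveI : IsSemisimpleRing A := IsArtinianRing.isSemisimpleRing_of_isReduced A
    haveI : IsSimpleRing (Module.End F V) := isSimpleRing_end'
    obtain ⟨L, hAL, hLss, hLmax, -, hdim⟩ := exists_le_maximal_comm_isSemisimpleRing A hcomm
    have hLcomm : ∀ x ∈ L, ∀ y ∈ L, x * y = y * x := hLmax.prop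
    haveI := hLss
    haveI : IsMulCommutative L := ⟨⟨fun a b => Subtype.ext (hLcomm a a.2 b b.2)⟩⟩
    -- a commutative semisimple ring is reduced: a nilpotent lies in every maximal ideal, and `J(L) = 0`
    haveI : IsReduced L := ⟨fun x hx => by
      obtain ⟨n, eq⟩ := hx
      exact (IsSemisimpleRing.jacobson_eq_bot ↥L).le <| Ideal.mem_sInf.mpr
        fun I hI => (Ideal.isMaximal_def.mpr hI).isPrime.mem_of_pow_mem n (eq ▸ I.zero_mem)⟩
    refine ⟨L, hAL, fun x hx => ?_, hLcomm, ‹_›, ?_⟩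
    · rw [Subalgebra.mem_centralizer_iff]
      exact fun a ha => hLcomm a (hAL ha) x hx
    · have h2 : finrank F ↥L ^ 2 = finrank F V ^ 2 := by rw [hdim, Module.finrank_linearMap, sq]
      exact Nat.pow_left_injective two_ne_zero h2

end Commutant

/-! ## §3 PROPOSITION 4.1: `[End(V, ρ) : F]_red = dim_F V` -/

section Prop41

variable {F : Type u} [Field F] {V : Type v} [AddCommGroup V] [Module F V] [FiniteDimensional F V]

/-- **MILNE CM PROP. 4.1: `[End(V, ρ) : F]_red = dim_F V`** — for a commutative reduced subalgebra `A ⊆ End_F(V)` (the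
algebra through which a group of multiplicative type acts), the commutant `C(A) = End(V, ρ)` has reduced degree exactly
`dim_F V`: `≥` by §2 (`C(A) ⊇ L` commutative reduced of dimension `dim V`), `≤` by Prop. 1.2 (`C(A) ⊆ End_F(V)` acts
faithfully on `V`).  Any field `F` (the print assumes characteristic `0`).
[cite: MilneCM2006, Ch. I §4 Prop. 4.1 (p. 34)] -/
theorem reducedDegree_centralizer_eq_finrank (A : Subalgebra F (Module.End F V))
    (hcomm : ∀ x ∈ A, ∀ y ∈ A, x * y = y * x) [IsReduced A] :
    reducedDegree F ↥(Subalgebra.centralizer F (A : Set (Module.End F V))) = finrank F V := by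
  apply le_antisymm (reducedDegree_le_finrank_of_le_end _)
  obtain ⟨L, -, hLC, hLcomm, hLred, hdim⟩ := exists_le_le_centralizer_comm_isReduced_finrank_eq A hcomm
  haveI := hLred
  calc finrank F V = finrank F ↥L := hdim.symm
    _ = reducedDegree F ↥L :=
        (reducedDegree_eq_finrank_of_comm (F := F) (B := ↥L) (fun x y => Subtype.ext (hLcomm x x.2 y y.2))).symm
    _ ≤ reducedDegree F ↥(Subalgebra.centralizer F (A : Set (Module.End F V))) :=
        reducedDegree_le_of_injective (Subalgebra.inclusion hLC) (Subalgebra.inclusion_injective hLC)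

/-- **The form used for Prop. 4.2: «`End⁰(A) ⊇ End(H₁(A, ℚ), ρ)`, and Proposition 4.1 shows that `A` has complex
multiplication»** — any subalgebra `R ⊆ End_F(V)` containing the commutant of a commutative reduced `A` has
`[R : F]_red = dim_F V`. [cite: MilneCM2006, Ch. I §4 Prop. 4.1 (p. 34) and Prop. 4.2 (proof, p. 35)] -/
theorem reducedDegree_eq_finrank_of_centralizer_le (A : Subalgebra F (Module.End F V))
    (hcomm : ∀ x ∈ A, ∀ y ∈ A, x * y = y * x) [IsReduced A] (R : Subalgebra F (Module.End F V))
    (h : Subalgebra.centralizer F (A : Set (Module.End F V)) ≤ R) : reducedDegree F ↥R = finrank F V := by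
  apply le_antisymm (reducedDegree_le_finrank_of_le_end _)
  calc finrank F V = reducedDegree F ↥(Subalgebra.centralizer F (A : Set (Module.End F V))) :=
        (reducedDegree_centralizer_eq_finrank A hcomm).symm
    _ ≤ reducedDegree F ↥R := reducedDegree_le_of_injective (Subalgebra.inclusion h) (Subalgebra.inclusion_injective h)

/-- In particular such an `R` contains a commutative reduced (étale) subalgebra of dimension `dim_F V` — «Proposition 4.1
shows that `A` has complex multiplication» (Prop. 3.3 (b)). [cite: MilneCM2006, Ch. I §4 Prop. 4.2 (proof, p. 35) and §3 Prop. 3.3 (b)] -/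
theorem exists_comm_isReduced_finrank_eq_of_centralizer_le (A : Subalgebra F (Module.End F V))
    (hcomm : ∀ x ∈ A, ∀ y ∈ A, x * y = y * x) [IsReduced A] (R : Subalgebra F (Module.End F V))
    (h : Subalgebra.centralizer F (A : Set (Module.End F V)) ≤ R) :
    ∃ L : Subalgebra F (Module.End F V), L ≤ R ∧ (∀ x ∈ L, ∀ y ∈ L, x * y = y * x) ∧ IsReduced L ∧
      finrank F L = finrank F V := by
  obtain ⟨L, -, hLC, hLcomm, hLred, hdim⟩ := exists_le_le_centralizer_comm_isReduced_finrank_eq A hcomm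
  exact ⟨L, hLC.trans h, hLcomm, hLred, hdim⟩

/-- **Prop. 4.1 for a pairwise commuting set `S` of semisimple endomorphisms** (perfect field): the commutant of `S` has
reduced degree `dim_F V` (`C(S) = C(F[S])` and `F[S]` is commutative reduced, §1).
[cite: MilneCM2006, Ch. I §4 Prop. 4.1 (p. 34)] -/
theorem reducedDegree_centralizer_eq_finrank_of_forall_isSemisimple [PerfectField F] (S : Set (Module.End F V))
    (hS : ∀ a ∈ S, ∀ b ∈ S, a * b = b * a) (hss : ∀ a ∈ S, Module.End.IsSemisimple a) :
    reducedDegree F ↥(Subalgebra.centralizer F S) = finrank F V := by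
  haveI := isReduced_adjoin_of_forall_isSemisimple hS hss
  rw [reducedDegree_eq_of_algEquiv (Subalgebra.equivOfEq _ _ (centralizer_eq_centralizer_adjoin S))]
  exact reducedDegree_centralizer_eq_finrank (Algebra.adjoin F S) (adjoin_comm_of_comm hS)

/-- **Prop. 4.1 for one semisimple operator** (a torus of rank `≤ 1` up to isogeny; any field): the commutant of a
semisimple `f` has reduced degree `dim_F V`. [cite: MilneCM2006, Ch. I §4 Prop. 4.1 (p. 34)] -/
theorem reducedDegree_centralizer_singleton_eq_finrank (f : Module.End F V) (hf : f.IsSemisimple) :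
    reducedDegree F ↥(Subalgebra.centralizer F ({f} : Set (Module.End F V))) = finrank F V := by
  haveI : IsReduced ↥(Algebra.adjoin F ({f} : Set (Module.End F V))) :=
    isReduced_of_forall_isSemisimple _ fun _ hx => hf.of_mem_adjoin_singleton hx
  rw [reducedDegree_eq_of_algEquiv (Subalgebra.equivOfEq _ _ (centralizer_eq_centralizer_adjoin {f}))]
  exact reducedDegree_centralizer_eq_finrank (Algebra.adjoin F {f}) (adjoin_comm_of_comm (by simp))

/-- **Prop. 4.1 for a commutative group of semisimple automorphisms** (perfect field; the image `ρ(G(k̄)) ∩ GL(V)` of a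
group of multiplicative type, or a subtorus `T ⊆ GL_V` through its points): the commutant of a commutative subgroup
`G ≤ GL(V)` of semisimple elements has reduced degree `dim_F V`. [cite: MilneCM2006, Ch. I §4 Prop. 4.1 (p. 34) and Prop. 4.2 («a subtorus `T ↪ GL_{H₁(A,ℚ)}`», p. 35)] -/
theorem reducedDegree_centralizer_subgroup_eq_finrank [PerfectField F] (G : Subgroup (Module.End F V)ˣ)
    (hG : ∀ g ∈ G, ∀ h ∈ G, g * h = h * g) (hss : ∀ g ∈ G, Module.End.IsSemisimple (g : Module.End F V)) :
    reducedDegree F ↥(Subalgebra.centralizer F ((Units.val : (Module.End F V)ˣ → Module.End F V) '' (G : Set (Module.End F V)ˣ))) =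
      finrank F V := by
  refine reducedDegree_centralizer_eq_finrank_of_forall_isSemisimple _ ?_ ?_
  · rintro _ ⟨g, hg, rfl⟩ _ ⟨h, hh, rfl⟩
    rw [← Units.val_mul, ← Units.val_mul, hG g hg h hh]
  · rintro _ ⟨g, hg, rfl⟩
    exact hss g hg

end Prop41

/-! ## §4 Matrix forms: `V = F^ι`, `End(V) = M_ι(F)`, subtori of `GL_ι(F)` -/

section MatrixForms

variable {F : Type u} [Field F] {ι : Type w} [Fintype ι] [DecidableEq ι]

/-- **Prop. 4.1, matrix form**: for a commutative reduced `A ⊆ M_ι(F)`, the commutant of `A` in `M_ι(F)` has reduced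
degree `#ι`. Any field `F`. [cite: MilneCM2006, Ch. I §4 Prop. 4.1 (p. 34)] -/
theorem Matrix.reducedDegree_centralizer_eq_card (A : Subalgebra F (Matrix ι ι F))
    (hcomm : ∀ x ∈ A, ∀ y ∈ A, x * y = y * x) [IsReduced A] :
    reducedDegree F ↥(Subalgebra.centralizer F (A : Set (Matrix ι ι F))) = Fintype.card ι := by
  let e : Matrix ι ι F ≃ₐ[F] Module.End F (ι → F) := Matrix.toLinAlgEquiv'
  haveI := isReduced_map_algEquiv e A
  rw [← reducedDegree_map_algEquiv e, map_centralizer_algEquiv e, ← Module.finrank_fintype_fun_eq_card F,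
    image_coe_eq_coe_map e A]
  exact reducedDegree_centralizer_eq_finrank _ (map_comm_of_comm' A hcomm _)

/-- **Prop. 4.1 ∕ 4.2, matrix form**: a subalgebra `R ⊆ M_ι(F)` containing the commutant of a commutative reduced `A` has
reduced degree `#ι`. [cite: MilneCM2006, Ch. I §4 Prop. 4.1 (p. 34) and Prop. 4.2 (proof, p. 35)] -/
theorem Matrix.reducedDegree_eq_card_of_centralizer_le (A : Subalgebra F (Matrix ι ι F))
    (hcomm : ∀ x ∈ A, ∀ y ∈ A, x * y = y * x) [IsReduced A] (R : Subalgebra F (Matrix ι ι F))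
    (h : Subalgebra.centralizer F (A : Set (Matrix ι ι F)) ≤ R) : reducedDegree F ↥R = Fintype.card ι := by
  apply le_antisymm
  · calc reducedDegree F ↥R ≤ reducedDegree F (Matrix ι ι F) := reducedDegree_subalgebra_le R
      _ = Fintype.card ι := by
          rcases isEmpty_or_nonempty ι with hι | hι
          · haveI : Subsingleton (Matrix ι ι F) := ⟨fun a b => Matrix.ext fun i _ => (IsEmpty.false i).elim⟩
            rw [reducedDegree_eq_zero_of_subsingleton, Fintype.card_eq_zero]
          · exact reducedDegree_matrix ι
  · calc Fintype.card ι = reducedDegree F ↥(Subalgebra.centralizer F (A : Set (Matrix ι ι F))) :=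
        (Matrix.reducedDegree_centralizer_eq_card A hcomm).symm
      _ ≤ reducedDegree F ↥R := reducedDegree_le_of_injective (Subalgebra.inclusion h) (Subalgebra.inclusion_injective h)

/-- In particular such an `R ⊆ M_ι(F)` contains a commutative reduced subalgebra of dimension `#ι`.
[cite: MilneCM2006, Ch. I §4 Prop. 4.2 (proof, p. 35) and §3 Prop. 3.3 (b)] -/
theorem Matrix.exists_comm_isReduced_finrank_eq_card_of_centralizer_le (A : Subalgebra F (Matrix ι ι F))
    (hcomm : ∀ x ∈ A, ∀ y ∈ A, x * y = y * x) [IsReduced A] (R : Subalgebra F (Matrix ι ι F))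
    (h : Subalgebra.centralizer F (A : Set (Matrix ι ι F)) ≤ R) :
    ∃ L : Subalgebra F (Matrix ι ι F), L ≤ R ∧ IsReduced L ∧ (∀ x ∈ L, ∀ y ∈ L, x * y = y * x) ∧
      finrank F L = Fintype.card ι := by
  have hR := Matrix.reducedDegree_eq_card_of_centralizer_le A hcomm R h
  obtain ⟨L, hLcomm, hLred, hLdim⟩ := exists_finrank_eq_reducedDegree (F := F) (B := ↥R)
  refine ⟨L.map R.val, ?_, ?_, ?_, ?_⟩
  · rintro _ ⟨x, -, rfl⟩
    exact x.2
  · exact isReduced_of_injective (Subalgebra.equivMapOfInjective L R.val Subtype.val_injective).symm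
      (Subalgebra.equivMapOfInjective L R.val Subtype.val_injective).symm.injective
  · rintro _ ⟨a, ha, rfl⟩ _ ⟨b, hb, rfl⟩
    rw [← map_mul, ← map_mul, hLcomm a ha b hb]
  · rw [← hR, ← hLdim]
    exact (Subalgebra.equivMapOfInjective L R.val Subtype.val_injective).symm.toLinearEquiv.finrank_eq

/-- **Prop. 4.1 for a pairwise commuting set of semisimple matrices** (perfect field).
[cite: MilneCM2006, Ch. I §4 Prop. 4.1 (p. 34)] -/
theorem Matrix.reducedDegree_centralizer_eq_card_of_forall_isSemisimple [PerfectField F] (S : Set (Matrix ι ι F))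
    (hS : ∀ a ∈ S, ∀ b ∈ S, a * b = b * a) (hss : ∀ a ∈ S, Module.End.IsSemisimple (Matrix.toLin' a)) :
    reducedDegree F ↥(Subalgebra.centralizer F S) = Fintype.card ι := by
  let e : Matrix ι ι F ≃ₐ[F] Module.End F (ι → F) := Matrix.toLinAlgEquiv'
  rw [← reducedDegree_map_algEquiv e, map_centralizer_algEquiv e, ← Module.finrank_fintype_fun_eq_card F]
  refine reducedDegree_centralizer_eq_finrank_of_forall_isSemisimple _ ?_ ?_
  · rintro _ ⟨a, ha, rfl⟩ _ ⟨b, hb, rfl⟩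
    rw [← map_mul, ← map_mul, hS a ha b hb]
  · rintro _ ⟨a, ha, rfl⟩
    exact hss a ha

/-- **Prop. 4.1 ∕ 4.2 for «a subtorus `T ↪ GL_V`» read on points**: the commutant in `M_ι(F)` of a commutative subgroup
`T ≤ GL_ι(F)` consisting of semisimple elements has reduced degree `#ι` (perfect field `F`).
[cite: MilneCM2006, Ch. I §4 Prop. 4.1 (p. 34) and Prop. 4.2 (p. 35)] -/
theorem Matrix.reducedDegree_centralizer_generalLinearGroup_eq_card [PerfectField F] (T : Subgroup (GL ι F))
    (hT : ∀ g ∈ T, ∀ h ∈ T, g * h = h * g)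
    (hss : ∀ g ∈ T, Module.End.IsSemisimple (Matrix.toLin' ((g : GL ι F) : Matrix ι ι F))) :
    reducedDegree F ↥(Subalgebra.centralizer F
      ((fun g : GL ι F => ((g : GL ι F) : Matrix ι ι F)) '' (T : Set (GL ι F)))) = Fintype.card ι := by
  refine Matrix.reducedDegree_centralizer_eq_card_of_forall_isSemisimple _ ?_ ?_
  · rintro _ ⟨g, hg, rfl⟩ _ ⟨h, hh, rfl⟩
    rw [← Units.val_mul, ← Units.val_mul, hT g hg h hh]
  · rintro _ ⟨g, hg, rfl⟩
    exact hss g hg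

end MatrixForms

end Literature.RingTheory.CentralSimple
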